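import Summits.ValiantsHypothesis.ValiantsHypothesis.Theorems.KPlusLogSqLawWindowDescartesRoots

/-!
# The window Descartes rule — one-sided (Laguerre-type) forms

Seat val-sym-lift-p4 (g2), cell `pub-symmetroid`, 2026-08-26; sequel of `…WindowDescartesRoots` (GAP-LIFT §7).  The two ONE-SIDED
forms of the window Descartes rule (Laguerre's classical rules, here in dominance form), which together with the window form
localise Descartes' count along the whole archimedean Newton polygon:
* `window_descartes_card_roots_Ioi`: if the monomial of degree `q` dominates `f` at `b > 0`
  (`∑_{s ≠ q} |coeff f s| b^s < |coeff f q| b^q`), then `#{x > b : f x = 0} ≤ V(coeff f q, …, coeff f N)`;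
* `window_descartes_card_roots_Ioo_zero`: if the monomial of degree `p` dominates `f` at `a > 0`, then
  `#{0 < x < a : f x = 0} ≤ V(coeff f 0, …, coeff f p)`.
Proofs: a second dominance point for the LEADING coefficient far to the right (`top_dominant_of_large`; beyond it there are no
zeros, `eval_ne_zero_of_top_dominant`) resp. for the TRAILING coefficient near `0` (`bottom_dominant_of_small`,
`eval_ne_zero_of_bottom_dominant`), then the window form `window_descartes_card_roots`.  Summing the three forms over a
chain of dominance points `x₀ < … < xₙ` with indices `p₀ < … < pₙ` gives
`#{x > 0 : f x = 0} ≤ V(c_0..c_{p₀}) + Σ V(c_{p_i}..c_{p_{i+1}}) + V(c_{pₙ}..c_N) = V(c_0, …, c_N)` — Descartes' bound, now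
DISTRIBUTED over the windows.  HONEST FRAMING: theorems about real polynomials; nothing here asserts `WeakLifting`,
`TropicalB`, Conjecture B, `MatrixDescartes` (stmt-ValiantsHypothesis-18050) or anything on VP ≠ VNP. [this file's theorems;
ancestor: Laguerre, in Pólya–Szegő, Problems and Theorems in Analysis II, Part V, Ch. 1, §3]
-/

set_option linter.dupNamespace false
set_option autoImplicit false

namespace Summit.ValiantsHypothesis.ValiantsHypothesis.Theorems.KPlusLogSqLaw.WindowDescartes

open Polynomial

section Window

variable {a b : ℝ}

/-! ### One-sided forms (Laguerre-type): zeros above the last dominance point, zeros below the first one -/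

/-- trailing zero entries above `n` do not change the count. -/
theorem sgnChanges_slist_eq_of_zero_above (c : ℕ → ℝ) (n m : ℕ) (h : ∀ i, n < i → i ≤ n + m → c i = 0) :
    sgnChanges (slist c (n + m)) = sgnChanges (slist c n) := by
  induction m with
  | zero => rfl
  | succ m ih =>
    rw [show n + (m + 1) = (n + m) + 1 by ring, slist_succ, h (n + m + 1) (by omega) (by omega), sgnChanges_cons_zero]
    exact ih (fun i hi him => h i hi (by omega))

/-- appending zero entries does not change the count. -/
theorem sgnChanges_append_zeros (l L : List ℝ) (hL : ∀ z ∈ L, z = 0) : sgnChanges (l ++ L) = sgnChanges l := by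
  rw [← sgnChanges_filter_ne_zero, List.filter_append, ← sgnChanges_filter_ne_zero l]
  have : L.filter (· ≠ 0) = [] := List.filter_eq_nil_iff.mpr fun z hz => by simpa using hL z hz
  rw [this, List.append_nil]

/-- **dominance of the leading coefficient excludes zeros above**: if the leading index `D = natDegree f` dominates at
`b > 0`, then `f x ≠ 0` for every `x ≥ b` (the dominance only improves as `x` grows). -/
theorem eval_ne_zero_of_top_dominant (f : ℝ[X]) {N : ℕ} (hN : f.natDegree ≤ N) (hb : 0 < b)
    (hdb : ∑ s ∈ (Finset.range (N + 1)).erase f.natDegree, |f.coeff s| * b ^ s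
      < |f.coeff f.natDegree| * b ^ f.natDegree)
    {x : ℝ} (hx : b ≤ x) : f.eval x ≠ 0 := by
  set D := f.natDegree with hD
  set E := (Finset.range (N + 1)).erase D with hE
  have hx0 : 0 < x := hb.trans_le hx
  have hmem : D ∈ Finset.range (N + 1) := by simp; omega
  set T := ∑ s ∈ E, f.coeff s * x ^ s with hT
  have hsum : f.eval x = f.coeff D * x ^ D + T := by
    rw [Polynomial.eval_eq_sum_range' (Nat.lt_succ_of_le hN), ← Finset.add_sum_erase _ _ hmem]
  have key : b ^ D * ∑ s ∈ E, |f.coeff s| * x ^ s ≤ x ^ D * ∑ s ∈ E, |f.coeff s| * b ^ s := by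
    rw [Finset.mul_sum, Finset.mul_sum]
    refine Finset.sum_le_sum fun s hs => ?_
    by_cases hsD : s ≤ D
    · obtain ⟨t, ht⟩ := Nat.exists_eq_add_of_le hsD
      have hbt : b ^ t ≤ x ^ t := pow_le_pow_left₀ hb.le hx t
      have e1 : b ^ D * (|f.coeff s| * x ^ s) = |f.coeff s| * (b ^ s * x ^ s) * b ^ t := by rw [ht, pow_add]; ring
      have e2 : x ^ D * (|f.coeff s| * b ^ s) = |f.coeff s| * (b ^ s * x ^ s) * x ^ t := by rw [ht, pow_add]; ring
      rw [e1, e2]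
      exact mul_le_mul_of_nonneg_left hbt (by positivity)
    · have : f.coeff s = 0 := coeff_eq_zero_of_natDegree_lt (by omega)
      simp [this]
  have habsT : |T| ≤ ∑ s ∈ E, |f.coeff s| * x ^ s :=
    (Finset.abs_sum_le_sum_abs _ _).trans (le_of_eq (Finset.sum_congr rfl fun s _ => by
      rw [abs_mul, abs_of_nonneg (pow_nonneg hx0.le _)]))
  have h1 : b ^ D * |T| < b ^ D * (|f.coeff D| * x ^ D) := by
    calc b ^ D * |T| ≤ b ^ D * ∑ s ∈ E, |f.coeff s| * x ^ s := mul_le_mul_of_nonneg_left habsT (pow_nonneg hb.le _)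
      _ ≤ x ^ D * ∑ s ∈ E, |f.coeff s| * b ^ s := key
      _ < x ^ D * (|f.coeff D| * b ^ D) := mul_lt_mul_of_pos_left hdb (pow_pos hx0 D)
      _ = b ^ D * (|f.coeff D| * x ^ D) := by ring
  have h2 : |T| < |f.coeff D| * x ^ D := lt_of_mul_lt_mul_left h1 (pow_nonneg hb.le D)
  intro h0
  rw [hsum] at h0
  have : T = -(f.coeff D * x ^ D) := by linarith
  rw [this, abs_neg, abs_mul, abs_of_nonneg (pow_nonneg hx0.le _)] at h2
  exact lt_irrefl _ h2

/-- the leading coefficient dominates at every `B ≥ 1` with `|lead| · B > ∑_{s < natDegree} |coeff s|`. -/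
theorem top_dominant_of_large (f : ℝ[X]) (hf : f ≠ 0) {N : ℕ} (hN : f.natDegree ≤ N) {B : ℝ} (hB1 : 1 ≤ B)
    (hB : ∑ s ∈ Finset.range f.natDegree, |f.coeff s| < |f.coeff f.natDegree| * B) :
    ∑ s ∈ (Finset.range (N + 1)).erase f.natDegree, |f.coeff s| * B ^ s < |f.coeff f.natDegree| * B ^ f.natDegree := by
  set D := f.natDegree with hD
  have hsub : Finset.range D ⊆ (Finset.range (N + 1)).erase D := fun s hs => by
    rw [Finset.mem_range] at hs; rw [Finset.mem_erase, Finset.mem_range]; omega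
  rw [← Finset.sum_subset hsub (fun s hs hs' => by
    rw [Finset.mem_erase, Finset.mem_range] at hs; rw [Finset.mem_range] at hs'
    rw [coeff_eq_zero_of_natDegree_lt (by omega), abs_zero, zero_mul])]
  rcases Nat.eq_zero_or_pos D with hD0 | hD0
  · rw [hD0, Finset.range_zero, Finset.sum_empty, pow_zero, mul_one]
    exact abs_pos.mpr (by rw [← hD0]; exact leadingCoeff_ne_zero.mpr hf)
  · have hB0 : 0 < B := by linarith
    calc ∑ s ∈ Finset.range D, |f.coeff s| * B ^ s ≤ ∑ s ∈ Finset.range D, |f.coeff s| * B ^ (D - 1) := by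
          refine Finset.sum_le_sum fun s hs => mul_le_mul_of_nonneg_left ?_ (abs_nonneg _)
          rw [Finset.mem_range] at hs
          exact pow_le_pow_right₀ hB1 (by omega)
      _ = (∑ s ∈ Finset.range D, |f.coeff s|) * B ^ (D - 1) := by rw [Finset.sum_mul]
      _ < |f.coeff D| * B * B ^ (D - 1) := mul_lt_mul_of_pos_right hB (pow_pos hB0 _)
      _ = |f.coeff D| * B ^ D := by
          rw [mul_assoc, ← pow_succ', Nat.sub_add_cancel hD0]

/-- **One-sided form above** (Laguerre-type): if the monomial of degree `q` dominates `f` at `b > 0`, the number of distinct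
zeros of `f` in `(b, ∞)` is at most `V(coeff f q, …, coeff f N)`. -/
theorem window_descartes_card_roots_Ioi (f : ℝ[X]) {N : ℕ} (hN : f.natDegree ≤ N) (hb : 0 < b) {q : ℕ}
    (hdb : ∑ s ∈ (Finset.range (N + 1)).erase q, |f.coeff s| * b ^ s < |f.coeff q| * b ^ q) :
    ((f.roots.toFinset).filter (fun x => b < x)).card ≤ sgnChanges (slist (fun i => f.coeff (q + i)) (N - q)) := by
  have hcq : f.coeff q ≠ 0 := by
    intro h0; rw [h0, abs_zero, zero_mul] at hdb
    exact absurd hdb (not_lt.mpr (Finset.sum_nonneg fun s _ => mul_nonneg (abs_nonneg _) (pow_nonneg hb.le _)))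
  have hf : f ≠ 0 := fun h => hcq (by rw [h, coeff_zero])
  set D := f.natDegree with hD
  have hqD : q ≤ D := le_natDegree_of_ne_zero hcq
  -- the bound only sees the coefficients up to `D`
  have hRHS : sgnChanges (slist (fun i => f.coeff (q + i)) (N - q)) = sgnChanges (slist (fun i => f.coeff (q + i)) (D - q)) := by
    rw [show N - q = (D - q) + (N - D) by omega]
    exact sgnChanges_slist_eq_of_zero_above _ _ _ fun i hi _ => coeff_eq_zero_of_natDegree_lt (by omega)
  rw [hRHS]
  rcases hqD.eq_or_lt with hqD' | hqD'
  · -- the leading coefficient dominates at `b`: no zero above `b`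
    have hnone : (f.roots.toFinset).filter (fun x => b < x) = ∅ := by
      refine Finset.filter_eq_empty_iff.mpr fun x hx hbx => ?_
      rw [Multiset.mem_toFinset, mem_roots hf] at hx
      exact eval_ne_zero_of_top_dominant f hN hb (by rw [← hD, ← hqD']; exact hdb) hbx.le hx
    rw [hnone, Finset.card_empty]; exact Nat.zero_le _
  · -- a second dominance point `B` for the leading coefficient, beyond all zeros
    set B := max b 1 + (∑ s ∈ Finset.range D, |f.coeff s|) / |f.coeff D| + 1 with hB
    have hlc : 0 < |f.coeff D| := abs_pos.mpr (leadingCoeff_ne_zero.mpr hf)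
    have hS0 : 0 ≤ (∑ s ∈ Finset.range D, |f.coeff s|) / |f.coeff D| :=
      div_nonneg (Finset.sum_nonneg fun s _ => abs_nonneg _) hlc.le
    have hB1 : 1 ≤ B := by rw [hB]; linarith [le_max_right b 1]
    have hbB : b < B := by rw [hB]; linarith [le_max_left b 1]
    have hBdom : ∑ s ∈ Finset.range D, |f.coeff s| < |f.coeff D| * B := by
      have e : |f.coeff D| * ((∑ s ∈ Finset.range D, |f.coeff s|) / |f.coeff D|) = ∑ s ∈ Finset.range D, |f.coeff s| := by
        field_simp
      rw [hB]; nlinarith [le_max_right b 1]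
    have hdB := top_dominant_of_large f hf hN hB1 hBdom
    have hsub : (f.roots.toFinset).filter (fun x => b < x) ⊆ (f.roots.toFinset).filter (fun x => b < x ∧ x < B) := by
      intro x hx
      rw [Finset.mem_filter] at hx ⊢
      refine ⟨hx.1, hx.2, lt_of_not_ge fun hBx => ?_⟩
      have hr := hx.1; rw [Multiset.mem_toFinset, mem_roots hf] at hr
      exact eval_ne_zero_of_top_dominant f hN (lt_of_lt_of_le hb hbB.le) hdB hBx hr
    exact (Finset.card_le_card hsub).trans (window_descartes_card_roots f hN hb hbB hqD' hdb hdB)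

/-- **dominance of the trailing coefficient excludes zeros below**: if the trailing index `t = natTrailingDegree f`
dominates at `a > 0`, then `f x ≠ 0` for every `0 < x ≤ a`. -/
theorem eval_ne_zero_of_bottom_dominant (f : ℝ[X]) {N : ℕ} (hN : f.natDegree ≤ N) (ha : 0 < a)
    (hda : ∑ s ∈ (Finset.range (N + 1)).erase f.natTrailingDegree, |f.coeff s| * a ^ s
      < |f.coeff f.natTrailingDegree| * a ^ f.natTrailingDegree)
    {x : ℝ} (hx0 : 0 < x) (hxa : x ≤ a) : f.eval x ≠ 0 := by
  set t := f.natTrailingDegree with ht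
  set E := (Finset.range (N + 1)).erase t with hE
  have hct : f.coeff t ≠ 0 := by
    intro h0; rw [h0, abs_zero, zero_mul] at hda
    exact absurd hda (not_lt.mpr (Finset.sum_nonneg fun s _ => mul_nonneg (abs_nonneg _) (pow_nonneg ha.le _)))
  have htN : t ≤ N := (le_natDegree_of_ne_zero hct).trans hN
  have hmem : t ∈ Finset.range (N + 1) := by simp; omega
  set T := ∑ s ∈ E, f.coeff s * x ^ s with hT
  have hsum : f.eval x = f.coeff t * x ^ t + T := by
    rw [Polynomial.eval_eq_sum_range' (Nat.lt_succ_of_le hN), ← Finset.add_sum_erase _ _ hmem]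
  have key : a ^ t * ∑ s ∈ E, |f.coeff s| * x ^ s ≤ x ^ t * ∑ s ∈ E, |f.coeff s| * a ^ s := by
    rw [Finset.mul_sum, Finset.mul_sum]
    refine Finset.sum_le_sum fun s hs => ?_
    by_cases hst : t ≤ s
    · obtain ⟨u, hu⟩ := Nat.exists_eq_add_of_le hst
      have hxu : x ^ u ≤ a ^ u := pow_le_pow_left₀ hx0.le hxa u
      have e1 : a ^ t * (|f.coeff s| * x ^ s) = |f.coeff s| * (a ^ t * x ^ t) * x ^ u := by rw [hu, pow_add]; ring
      have e2 : x ^ t * (|f.coeff s| * a ^ s) = |f.coeff s| * (a ^ t * x ^ t) * a ^ u := by rw [hu, pow_add]; ring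
      rw [e1, e2]
      exact mul_le_mul_of_nonneg_left hxu (by positivity)
    · have : f.coeff s = 0 := coeff_eq_zero_of_lt_natTrailingDegree (by omega)
      simp [this]
  have habsT : |T| ≤ ∑ s ∈ E, |f.coeff s| * x ^ s :=
    (Finset.abs_sum_le_sum_abs _ _).trans (le_of_eq (Finset.sum_congr rfl fun s _ => by
      rw [abs_mul, abs_of_nonneg (pow_nonneg hx0.le _)]))
  have h1 : a ^ t * |T| < a ^ t * (|f.coeff t| * x ^ t) := by
    calc a ^ t * |T| ≤ a ^ t * ∑ s ∈ E, |f.coeff s| * x ^ s := mul_le_mul_of_nonneg_left habsT (pow_nonneg ha.le _)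
      _ ≤ x ^ t * ∑ s ∈ E, |f.coeff s| * a ^ s := key
      _ < x ^ t * (|f.coeff t| * a ^ t) := mul_lt_mul_of_pos_left hda (pow_pos hx0 t)
      _ = a ^ t * (|f.coeff t| * x ^ t) := by ring
  have h2 : |T| < |f.coeff t| * x ^ t := lt_of_mul_lt_mul_left h1 (pow_nonneg ha.le t)
  intro h0
  rw [hsum] at h0
  have : T = -(f.coeff t * x ^ t) := by linarith
  rw [this, abs_neg, abs_mul, abs_of_nonneg (pow_nonneg hx0.le _)] at h2
  exact lt_irrefl _ h2

/-- the trailing coefficient dominates at every `0 < A ≤ 1` with `A · ∑_{s ≠ t} |coeff s| < |coeff t|`. -/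
theorem bottom_dominant_of_small (f : ℝ[X]) (N : ℕ) {A : ℝ} (hA0 : 0 < A) (hA1 : A ≤ 1)
    (hA : A * ∑ s ∈ (Finset.range (N + 1)).erase f.natTrailingDegree, |f.coeff s| < |f.coeff f.natTrailingDegree|) :
    ∑ s ∈ (Finset.range (N + 1)).erase f.natTrailingDegree, |f.coeff s| * A ^ s
      < |f.coeff f.natTrailingDegree| * A ^ f.natTrailingDegree := by
  set t := f.natTrailingDegree with ht
  calc ∑ s ∈ (Finset.range (N + 1)).erase t, |f.coeff s| * A ^ s
      ≤ ∑ s ∈ (Finset.range (N + 1)).erase t, |f.coeff s| * A ^ (t + 1) := by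
        refine Finset.sum_le_sum fun s hs => ?_
        by_cases hst : t < s
        · exact mul_le_mul_of_nonneg_left (pow_le_pow_of_le_one hA0.le hA1 (by omega)) (abs_nonneg _)
        · rw [Finset.mem_erase] at hs
          rw [coeff_eq_zero_of_lt_natTrailingDegree (by omega), abs_zero, zero_mul, zero_mul]
    _ = A ^ t * (A * ∑ s ∈ (Finset.range (N + 1)).erase t, |f.coeff s|) := by
        rw [Finset.mul_sum, Finset.mul_sum]; exact Finset.sum_congr rfl fun s _ => by ring
    _ < A ^ t * |f.coeff t| := mul_lt_mul_of_pos_left hA (pow_pos hA0 t)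
    _ = |f.coeff t| * A ^ t := mul_comm _ _

/-- **One-sided form below** (Laguerre-type): if the monomial of degree `p` dominates `f` at `a > 0`, the number of distinct
zeros of `f` in `(0, a)` is at most `V(coeff f 0, …, coeff f p)`. -/
theorem window_descartes_card_roots_Ioo_zero (f : ℝ[X]) {N : ℕ} (hN : f.natDegree ≤ N) (ha : 0 < a) {p : ℕ}
    (hda : ∑ s ∈ (Finset.range (N + 1)).erase p, |f.coeff s| * a ^ s < |f.coeff p| * a ^ p) :
    ((f.roots.toFinset).filter (fun x => 0 < x ∧ x < a)).card ≤ sgnChanges (slist (fun i => f.coeff i) p) := by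
  have hcp : f.coeff p ≠ 0 := by
    intro h0; rw [h0, abs_zero, zero_mul] at hda
    exact absurd hda (not_lt.mpr (Finset.sum_nonneg fun s _ => mul_nonneg (abs_nonneg _) (pow_nonneg ha.le _)))
  have hf : f ≠ 0 := fun h => hcp (by rw [h, coeff_zero])
  have hpN : p ≤ N := (le_natDegree_of_ne_zero hcp).trans hN
  set t := f.natTrailingDegree with ht
  have htp : t ≤ p := natTrailingDegree_le_of_ne_zero hcp
  -- the bound only sees the coefficients from `t` on
  have hRHS : sgnChanges (slist (fun i => f.coeff i) p) = sgnChanges (slist (fun i => f.coeff (t + i)) (p - t)) := by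
    rcases Nat.eq_zero_or_pos t with ht0 | ht0
    · rw [ht0, Nat.sub_zero]; exact congrArg sgnChanges (slist_congr fun i _ => by rw [Nat.zero_add])
    · obtain ⟨t', ht'⟩ : ∃ t', t = t' + 1 := ⟨t - 1, by omega⟩
      have e : slist (fun i => f.coeff i) p = slist (fun i => f.coeff (t + i)) (p - t) ++ slist (fun i => f.coeff i) t' := by
        rw [show p = t' + (p - t) + 1 by omega, slist_add, show t' + (p - t) + 1 - t = p - t by omega]
        congr 1
        exact slist_congr fun k _ => by rw [ht']
      rw [e]
      refine sgnChanges_append_zeros _ _ fun z hz => ?_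
      obtain ⟨i, hi, rfl⟩ := mem_slist_iff.mp hz
      exact coeff_eq_zero_of_lt_natTrailingDegree (by omega)
  rw [hRHS]
  rcases htp.eq_or_lt with htp' | htp'
  · -- the trailing coefficient dominates at `a`: no zero in `(0, a]`
    have hnone : (f.roots.toFinset).filter (fun x => 0 < x ∧ x < a) = ∅ := by
      refine Finset.filter_eq_empty_iff.mpr fun x hx hx' => ?_
      rw [Multiset.mem_toFinset, mem_roots hf] at hx
      exact eval_ne_zero_of_bottom_dominant f hN ha (by rw [← ht, htp']; exact hda) hx'.1 hx'.2.le hx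
    rw [hnone, Finset.card_empty]; exact Nat.zero_le _
  · -- a second dominance point `A` for the trailing coefficient, below all zeros
    set S := ∑ s ∈ (Finset.range (N + 1)).erase t, |f.coeff s| with hS
    have hS0 : 0 ≤ S := Finset.sum_nonneg fun s _ => abs_nonneg _
    have hct : 0 < |f.coeff t| := abs_pos.mpr (by rw [ht]; exact mt trailingCoeff_eq_zero.mp hf)
    set A := min (min (a / 2) (1 / 2)) (|f.coeff t| / (2 * (S + 1))) with hA
    have hA0 : 0 < A := lt_min (lt_min (half_pos ha) (by norm_num)) (div_pos hct (by linarith))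
    have hAa : A < a := lt_of_le_of_lt ((min_le_left _ _).trans (min_le_left _ _)) (by linarith)
    have hA1 : A ≤ 1 := ((min_le_left _ _).trans (min_le_right _ _)).trans (by norm_num)
    have hAS : A * S < |f.coeff t| := by
      have h1 : A ≤ |f.coeff t| / (2 * (S + 1)) := min_le_right _ _
      have h2 : |f.coeff t| / (2 * (S + 1)) * S ≤ |f.coeff t| / 2 := by
        rw [div_mul_eq_mul_div, div_le_div_iff₀ (by linarith) (by norm_num)]
        nlinarith
      nlinarith
    have hdA := bottom_dominant_of_small f N hA0 hA1 hAS
    have hsub : (f.roots.toFinset).filter (fun x => 0 < x ∧ x < a) ⊆ (f.roots.toFinset).filter (fun x => A < x ∧ x < a) := by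
      intro x hx
      rw [Finset.mem_filter] at hx ⊢
      refine ⟨hx.1, lt_of_not_ge fun hxA => ?_, hx.2.2⟩
      have hr := hx.1; rw [Multiset.mem_toFinset, mem_roots hf] at hr
      exact eval_ne_zero_of_bottom_dominant f hN hA0 hdA hx.2.1 hxA hr
    exact (Finset.card_le_card hsub).trans (window_descartes_card_roots f hN hA0 hAa htp' hdA hda)

end Window

end Summit.ValiantsHypothesis.ValiantsHypothesis.Theorems.KPlusLogSqLaw.WindowDescartes
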